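import Literature.NumberTheory.Automorphic.UnitaryGroupOrbitalMeasureFamilyOfLocalAdelic
import Literature.NumberTheory.Automorphic.UnitaryGroupPatchedFamiliesTransport
import Literature.NumberTheory.Rogawski1990.AdelicStableConjugacyG2
import Literature.NumberTheory.Rogawski1990.AdelicStableOrbitalIntegral
import HarnessLib

/-!
# (β) THE PATCHED-FAMILY BRIDGE on the adelic stable class of a NON-regular `γ₀`: `ofLocalAdelic m^{G′,p} m^{G′,p}_∞ = ofLocalAdelic m^{G′,s} m^{G′,s}_∞`
# on `MatchingAdeleG₂.classes L H₁ H₂ γ₀` (Rogawski (1990), §5.4 (5.4.3) pp. 72–73, §14.5 p. 239)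

Topic `NumberTheory/Automorphic`; namespace `Literature.NumberTheory.Automorphic.UnitaryGroup`; THEOREMS ONLY (no definition, no instance, no named fact,
no `sorry`).  Cell `pub/hodgecm-mathlib`, ENGINE T1 line `F0_T1InnerFormTraceIdentity` (crux item stmt-HodgeConjecture-24833), row **(F-1) (β)** (O7 OWNER WORD
#41: «(β) (patched-family bridge `ofLocalAdelic mGp mGip = ofLocalAdelic mGs mGis` on `MatchingAdeleG₂.classes L H H γ₀`, γ₀ singular — every local component
of a matching class is singular, so it is `if_neg` placewise under the product): belongs to (F-1) — p06 exports it as a named lemma; (F-2) v2 and (F-4) consume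
it by name»).
* §1 (any `N`, `H`) **`OrbitalMeasureFamily.ofLocalAdelic_congr_point`**: ★ `ofLocalAdelic mG mGi c` reads the local families only through their members at
  the classes `⟦(out c)_v⟧`, `⟦(out c)_∞⟧` (★ `OrbitalMeasureFamily.atPoint`) — two pairs of families with the same members there, admissible at those classes,
  give the same measure at `c` (both branches of the defining `dite`: the normalising exceptional sets coincide by ★ `isNormalisedOff_congr_point`, and ★
  `ofLocalAdelic_eq` removes the dependence on the chosen set).
* §2 (`N = 3`, forms `H₁`, `H₂`) **`OrbitalMeasureFamily.ofLocalAdelic_eq_of_mem_classes_of_not_isRegularElt`**: for a NON-regular rational `γ₀ ∈ U(H₁)(L⁺)`,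
  families `(m^p, m^p_∞)` agreeing with `(m^s, m^s_∞)` OFF the regular classes, and `m^s` admissible on the local stable classes of the `(γ₀)_v` ((ADM) of ★
  `SingularEllipticTransferCanonical`): `ofLocalAdelic m^p m^p_∞ c = ofLocalAdelic m^s m^s_∞ c` at every `c ∈ MatchingAdeleG₂.classes L H₁ H₂ γ₀` (the
  components of `out c` correspond to the non-regular `(γ₀)_v`, `γ₀ ⊗ 1`: ★ `isRegularElt_iff_of_corresponds`, ★ `not_isRegularElt_toLocal_toAdelic`,
  ★ `not_isRegularElt_cmRationalToArch`); and **`adelicStableOrbitalSum_ofLocalAdelic_congr_of_not_isRegularElt`**: hence the all-classes adelic orbital sums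
  `Σ_{c ∈ 𝒞_𝐀(γ₀)} Φ(c, F)` of the two families agree — what turns ★ `SingularTransferMembers.kappaConst_spec` (stated for the singular members) into the
  (κ-MASS) identity for the KIT's patched families (pin (xiii″-s∕κ) `PinSingularEndoscopicMass`, (F-2)∕(F-4)).
HC_CM is proved only modulo the printed citations (7 + `SingularEllipticTransferCanonical`) until rung 0 closes; this file proves no printed citation.

References: J. D. Rogawski, *Automorphic Representations of Unitary Groups in Three Variables* (1990), §5.4 (5.4.3) pp. 72–73, §14.5 p. 239 [Rogawski1990];
S. Gelbart, *Automorphic forms on adele groups* (1975), (9.13) [Gelbart1975].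
-/

set_option autoImplicit false

noncomputable section

open MeasureTheory Measure Set NumberField IsDedekindDomain
open Literature.MeasureTheory.Group Literature.NumberTheory.Rogawski1990
open scoped ENNReal NNReal Matrix MatrixGroups

namespace Literature.NumberTheory.Automorphic.UnitaryGroup

/-! ## §1 `ofLocalAdelic` reads the families only at the classes of the components of the representative -/

section Point

variable (L : Type) [Field L] [NumberField L] [IsCMField L] (N : ℕ) (H : Matrix (Fin N) (Fin N) L)
  [∀ g : (cmDatum L N H).Adelic, MeasurableSpace ((cmDatum L N H).Adelic ⧸ Subgroup.centralizer ({g} : Set (cmDatum L N H).Adelic))]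
  [∀ a : arch (↥(maximalRealSubfield L)) L (IsCMField.complexConj L) N H,
    MeasurableSpace (arch (↥(maximalRealSubfield L)) L (IsCMField.complexConj L) N H ⧸
      Subgroup.centralizer ({a} : Set (arch (↥(maximalRealSubfield L)) L (IsCMField.complexConj L) N H)))]
  [∀ (v : HeightOneSpectrum (𝓞 ↥(maximalRealSubfield L))) (x : (cmDatum L N H).Local v),
    MeasurableSpace ((cmDatum L N H).Local v ⧸ Subgroup.centralizer ({x} : Set ((cmDatum L N H).Local v)))]
  [∀ (v : HeightOneSpectrum (𝓞 ↥(maximalRealSubfield L))) (x : (cmDatum L N H).Local v),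
    BorelSpace ((cmDatum L N H).Local v ⧸ Subgroup.centralizer ({x} : Set ((cmDatum L N H).Local v)))]
  {mG mG' : ∀ v : HeightOneSpectrum (𝓞 ↥(maximalRealSubfield L)), OrbitalMeasureFamily ((cmDatum L N H).Local v)}
  {mGi mGi' : OrbitalMeasureFamily (arch (↥(maximalRealSubfield L)) L (IsCMField.complexConj L) N H)}

/-- **`ofLocalAdelic` at `c` depends on the families only through their members at `⟦(out c)_v⟧`, `⟦(out c)_∞⟧`** (given admissibility of those local
members): equal members there ⇒ `ofLocalAdelic mG′ mGi′ c = ofLocalAdelic mG mGi c`. [cite: Rogawski1990, §5.4 (5.4.3) p. 72] -/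
theorem OrbitalMeasureFamily.ofLocalAdelic_congr_point (c : ConjClasses (cmDatum L N H).Adelic)
    (hG : ∀ v, mG' v (ConjClasses.mk ((cmDatum L N H).toLocal v (Quotient.out c : (cmDatum L N H).Adelic))) =
      mG v (ConjClasses.mk ((cmDatum L N H).toLocal v (Quotient.out c : (cmDatum L N H).Adelic))))
    (hGi : mGi' (ConjClasses.mk (archPart (↥(maximalRealSubfield L)) L (IsCMField.complexConj L) N H (Quotient.out c : (cmDatum L N H).Adelic))) =
      mGi (ConjClasses.mk (archPart (↥(maximalRealSubfield L)) L (IsCMField.complexConj L) N H (Quotient.out c : (cmDatum L N H).Adelic))))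
    (hadm : ∀ v, mG v (ConjClasses.mk ((cmDatum L N H).toLocal v (Quotient.out c : (cmDatum L N H).Adelic))) ≠ 0 ∧
      SMulInvariantMeasure ((cmDatum L N H).Local v) _ (mG v (ConjClasses.mk ((cmDatum L N H).toLocal v (Quotient.out c : (cmDatum L N H).Adelic)))) ∧
      IsFiniteMeasureOnCompacts (mG v (ConjClasses.mk ((cmDatum L N H).toLocal v (Quotient.out c : (cmDatum L N H).Adelic))))) :
    OrbitalMeasureFamily.ofLocalAdelic L N H mG' mGi' c = OrbitalMeasureFamily.ofLocalAdelic L N H mG mGi c := by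
  classical
  have hpt : ∀ v, (mG' v).atPoint ((cmDatum L N H).toLocal v (Quotient.out c : (cmDatum L N H).Adelic)) =
      (mG v).atPoint ((cmDatum L N H).toLocal v (Quotient.out c : (cmDatum L N H).Adelic)) := fun v => by
    unfold OrbitalMeasureFamily.atPoint
    rw [hG v]
  have hpti : mGi'.atPoint (archPart (↥(maximalRealSubfield L)) L (IsCMField.complexConj L) N H (Quotient.out c : (cmDatum L N H).Adelic)) =
      mGi.atPoint (archPart (↥(maximalRealSubfield L)) L (IsCMField.complexConj L) N H (Quotient.out c : (cmDatum L N H).Adelic)) := by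
    unfold OrbitalMeasureFamily.atPoint
    rw [hGi]
  by_cases h : ∃ S₀, IsNormalisedOff L N H mG (Quotient.out c : (cmDatum L N H).Adelic) S₀
  · obtain ⟨S₀, hS₀⟩ := h
    have hS₀' : IsNormalisedOff L N H mG' (Quotient.out c : (cmDatum L N H).Adelic) S₀ :=
      isNormalisedOff_congr_point L mG mG' _ S₀ hG hS₀
    have hadm' : ∀ v, mG' v (ConjClasses.mk ((cmDatum L N H).toLocal v (Quotient.out c : (cmDatum L N H).Adelic))) ≠ 0 ∧
        SMulInvariantMeasure ((cmDatum L N H).Local v) _ (mG' v (ConjClasses.mk ((cmDatum L N H).toLocal v (Quotient.out c : (cmDatum L N H).Adelic)))) ∧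
        IsFiniteMeasureOnCompacts (mG' v (ConjClasses.mk ((cmDatum L N H).toLocal v (Quotient.out c : (cmDatum L N H).Adelic)))) := fun v => by
      rw [hG v]; exact hadm v
    rw [OrbitalMeasureFamily.ofLocalAdelic_eq L N H mG mGi c hS₀ hadm, OrbitalMeasureFamily.ofLocalAdelic_eq L N H mG' mGi' c hS₀' hadm']
    simp only [hpt, hpti]
  · have h' : ¬ ∃ S₀, IsNormalisedOff L N H mG' (Quotient.out c : (cmDatum L N H).Adelic) S₀ := fun ⟨S₀, hS₀'⟩ =>
      h ⟨S₀, isNormalisedOff_congr_point L mG' mG _ S₀ (fun v => (hG v).symm) hS₀'⟩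
    unfold OrbitalMeasureFamily.ofLocalAdelic
    rw [dif_neg h, dif_neg h']

end Point

/-! ## §2 The bridge on the adelic stable class of a non-regular `γ₀` -/

section Bridge

variable (L : Type) [Field L] [NumberField L] [IsCMField L] {H₁ : Matrix (Fin 3) (Fin 3) L} (H₂ : Matrix (Fin 3) (Fin 3) L)
  [∀ g : (cmDatum L 3 H₂).Adelic, MeasurableSpace ((cmDatum L 3 H₂).Adelic ⧸ Subgroup.centralizer ({g} : Set (cmDatum L 3 H₂).Adelic))]
  [∀ a : arch (↥(maximalRealSubfield L)) L (IsCMField.complexConj L) 3 H₂,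
    MeasurableSpace (arch (↥(maximalRealSubfield L)) L (IsCMField.complexConj L) 3 H₂ ⧸
      Subgroup.centralizer ({a} : Set (arch (↥(maximalRealSubfield L)) L (IsCMField.complexConj L) 3 H₂)))]
  [∀ (v : HeightOneSpectrum (𝓞 ↥(maximalRealSubfield L))) (x : (cmDatum L 3 H₂).Local v),
    MeasurableSpace ((cmDatum L 3 H₂).Local v ⧸ Subgroup.centralizer ({x} : Set ((cmDatum L 3 H₂).Local v)))]
  [∀ (v : HeightOneSpectrum (𝓞 ↥(maximalRealSubfield L))) (x : (cmDatum L 3 H₂).Local v),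
    BorelSpace ((cmDatum L 3 H₂).Local v ⧸ Subgroup.centralizer ({x} : Set ((cmDatum L 3 H₂).Local v)))]
  {mGp mGs : ∀ v : HeightOneSpectrum (𝓞 ↥(maximalRealSubfield L)), OrbitalMeasureFamily ((cmDatum L 3 H₂).Local v)}
  {mGip mGis : OrbitalMeasureFamily (arch (↥(maximalRealSubfield L)) L (IsCMField.complexConj L) 3 H₂)}

/-- **(β) `ofLocalAdelic m^p m^p_∞ = ofLocalAdelic m^s m^s_∞` ON THE ADELIC STABLE CLASS OF A NON-REGULAR `γ₀`**: for `γ₀ ∈ U(H₁)(L⁺)` non-regular, families on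
`U(H₂)` agreeing OFF the regular classes, and `m^s` admissible on the local classes corresponding to the `(γ₀)_v`, the two adelic families agree at every
`c ∈ 𝒞_𝐀(γ₀)` — each component of `out c` corresponds to a non-regular `(γ₀)_v` ∕ `γ₀ ⊗ 1`, hence is non-regular. [cite: Rogawski1990, §5.4 (5.4.3) pp. 72–73; §14.5 p. 239] -/
theorem OrbitalMeasureFamily.ofLocalAdelic_eq_of_mem_classes_of_not_isRegularElt {γ₀ : (cmDatum L 3 H₁).Rational}
    (hnreg : ¬ IsRegularElt (γ₀.val : GL (Fin 3) L))
    (hPs : ∀ v (c' : ConjClasses ((cmDatum L 3 H₂).Local v)), ¬ IsRegularElt ((Quotient.out c').val : GL (Fin 3) (LocalRing L v)) → mGp v c' = mGs v c')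
    (hPis : ∀ c' : ConjClasses (arch (↥(maximalRealSubfield L)) L (IsCMField.complexConj L) 3 H₂),
      ¬ IsRegularElt ((Quotient.out c').val : GL (Fin 3) (mixedEmbedding.mixedSpace L)) → mGip c' = mGis c')
    (hadmS : ∀ v, (mGs v).IsAdmissibleOn fun x : (cmDatum L 3 H₂).Local v =>
      Corresponds (conjLocal L (IsCMField.complexConj L) v) ((adelicForm L 3 H₁).map (adeleToLocal L v)) ((adelicForm L 3 H₂).map (adeleToLocal L v))
        ((cmDatum L 3 H₁).toLocal v ((cmDatum L 3 H₁).toAdelic γ₀)) x)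
    {c : ConjClasses (cmDatum L 3 H₂).Adelic} (hc : c ∈ MatchingAdeleG₂.classes L H₁ H₂ γ₀) :
    OrbitalMeasureFamily.ofLocalAdelic L 3 H₂ mGp mGip c = OrbitalMeasureFamily.ofLocalAdelic L 3 H₂ mGs mGis c := by
  obtain ⟨q, hq⟩ := MatchingAdeleG₂.exists_adele_eq_out_of_mem_classes hc
  -- the components of `out c = q.adele` correspond to `(γ₀)_v`, `γ₀ ⊗ 1`
  have hcv : ∀ v, Corresponds (conjLocal L (IsCMField.complexConj L) v) ((adelicForm L 3 H₁).map (adeleToLocal L v)) ((adelicForm L 3 H₂).map (adeleToLocal L v))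
      ((cmDatum L 3 H₁).toLocal v ((cmDatum L 3 H₁).toAdelic γ₀)) ((cmDatum L 3 H₂).toLocal v (Quotient.out c : (cmDatum L 3 H₂).Adelic)) := fun v => by
    rw [← hq]; exact q.corresponds_toLocal v
  have hci : Corresponds (conjMixed (↥(maximalRealSubfield L)) L (IsCMField.complexConj L)) (archFormOf L 3 H₁) (archFormOf L 3 H₂) (cmRationalToArch L 3 H₁ γ₀)
      (archPart (↥(maximalRealSubfield L)) L (IsCMField.complexConj L) 3 H₂ (Quotient.out c : (cmDatum L 3 H₂).Adelic)) := by
    rw [← hq]; exact q.corresponds_arch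
  refine OrbitalMeasureFamily.ofLocalAdelic_congr_point L 3 H₂ c (fun v => hPs v _ fun hreg => ?_) (hPis _ fun hreg => ?_) (fun v => ?_)
  · -- `out ⟦(out c)_v⟧` regular ⇒ `(out c)_v` regular ⇒ `(γ₀)_v` regular — contradiction
    exact not_isRegularElt_toLocal_toAdelic L γ₀ hnreg v
      ((isRegularElt_iff_of_corresponds (hcv v)).2 ((isRegularElt_iff_of_isConj_local L H₂ v (isConj_out_conjClasses_mk _)).2 hreg))
  · exact not_isRegularElt_cmRationalToArch L γ₀ hnreg
      ((isRegularElt_iff_of_corresponds hci).2 ((isRegularElt_iff_of_isConj_arch (isConj_out_conjClasses_mk _)).2 hreg))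
  · -- (ADM) at the class of `(out c)_v`, which corresponds to `(γ₀)_v`
    exact (hadmS v).at_mk _ ((hcv v).trans (isStablyConj_of_isConj (isConj_out_conjClasses_mk _)))

/-- **(β) for the all-classes adelic orbital sums**: `Σ_{c ∈ 𝒞_𝐀(γ₀)} Φ(ofLocalAdelic m^p m^p_∞; c, F) = Σ_{c ∈ 𝒞_𝐀(γ₀)} Φ(ofLocalAdelic m^s m^s_∞; c, F)` for a
non-regular `γ₀` (same hypotheses) — the (κ-MASS) identity of ★ `SingularTransferMembers.kappaConst_spec` therefore holds VERBATIM for the patched families.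
[cite: Rogawski1990, §5.4 (5.4.3) pp. 72–73; §14.5 Lemma 14.5.2 (b) p. 239] -/
theorem adelicStableOrbitalSum_ofLocalAdelic_congr_of_not_isRegularElt {γ₀ : (cmDatum L 3 H₁).Rational}
    (hnreg : ¬ IsRegularElt (γ₀.val : GL (Fin 3) L))
    (hPs : ∀ v (c' : ConjClasses ((cmDatum L 3 H₂).Local v)), ¬ IsRegularElt ((Quotient.out c').val : GL (Fin 3) (LocalRing L v)) → mGp v c' = mGs v c')
    (hPis : ∀ c' : ConjClasses (arch (↥(maximalRealSubfield L)) L (IsCMField.complexConj L) 3 H₂),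
      ¬ IsRegularElt ((Quotient.out c').val : GL (Fin 3) (mixedEmbedding.mixedSpace L)) → mGip c' = mGis c')
    (hadmS : ∀ v, (mGs v).IsAdmissibleOn fun x : (cmDatum L 3 H₂).Local v =>
      Corresponds (conjLocal L (IsCMField.complexConj L) v) ((adelicForm L 3 H₁).map (adeleToLocal L v)) ((adelicForm L 3 H₂).map (adeleToLocal L v))
        ((cmDatum L 3 H₁).toLocal v ((cmDatum L 3 H₁).toAdelic γ₀)) x)
    (F : (cmDatum L 3 H₂).Adelic → ℂ) :
    adelicStableOrbitalSum (MatchingAdeleG₂.classes L H₁ H₂ γ₀) (OrbitalMeasureFamily.ofLocalAdelic L 3 H₂ mGp mGip) F =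
      adelicStableOrbitalSum (MatchingAdeleG₂.classes L H₁ H₂ γ₀) (OrbitalMeasureFamily.ofLocalAdelic L 3 H₂ mGs mGis) F := by
  unfold adelicStableOrbitalSum
  exact finsum_mem_congr rfl fun c hc => classOrbitalIntegral_congr_of_eq
    (OrbitalMeasureFamily.ofLocalAdelic_eq_of_mem_classes_of_not_isRegularElt L H₂ hnreg hPs hPis hadmS hc) F

end Bridge

end Literature.NumberTheory.Automorphic.UnitaryGroup

end
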